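import Summits.QuantumFields.QCD.Theorems.QuarksAsStableActionCriticalLineDiamagnetismCheckerDefs
import Literature.Analysis.ValidatedNumerics.AffineArithmeticInv

/-!
# Block-margin certificate checker — definitions, part 2: the affine-arithmetic leaf test (crux stmt-QuantumFields-9734, lead c3)

The leaf test of the bisection driver of `…CheckerDefs.lean`, evaluated in the fixed-point AFFINE ARITHMETIC of
`Literature/Analysis/ValidatedNumerics/AffineArithmetic(Inv).lean` (first-order correlations between the sixteen
shifted symbols are kept; plain interval arithmetic loses a factor ≈ 20–36 in width here and is infeasible):

* `cForm` (coordinate `k` of a box as the form `c + w ε_k`), `Ctx`/`mkCtx` (per-box shared forms: `C_k`, `1 − C_k²`,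
  `A(b)`, `1/h(b)`, tadpoles, `W(bs)`, and the products `A A'`, `h⁻¹h'⁻¹`, `C C`, `C S2`, `S2 S2`), `tForm`, `bubForm`,
  `entryForm` (the closed form `blockHc` mirrored on forms, classes and shifts as bit masks, `σ + s ↔ xor`),
  `loQ`/`hiQ`, `entryTable`, `blockOKbits`, `leafOK`, `certifyRegion γ fuel r` (all root boxes of region `r` pass);
* proof-side bookkeeping definitions: `IBox.cen`/`IBox.hw`, `noise` (the noise vector of a point of a box), `Cn`
  (coordinates on `ℕ`), `CtxSound` (what a context encloses at a point).

All at scale `SC = 2²⁰`. Soundness: `…CheckerEvalSound*.lean`; certificates `…CheckerCert*.lean` (`native_decide`,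
≈ 3–9·10³ leaves per region). No facts, no axioms.
-/

namespace Summit.QuantumFields.QCD.Cruxes.CriticalLineDiamagnetism.ChessboardCellGain.Checker

open Finset
/-! ### The affine-arithmetic leaf test (part 2 of the definitions) -/

section Eval

open Literature.Analysis.ValidatedNumerics

/-- The sign `σ_k ∈ {±1}` of bit `k` of a mask, as an integer. -/
def sgnZ (b k : ℕ) : ℤ := if b.testBit k then -1 else 1

/-- The affine form of coordinate `k` of a box: centre `⌊(lo+hi)/2⌋`, half-width `hi − centre`, noise symbol `k`. -/
def cForm (B : IBox) (k : ℕ) : AForm :=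
  let I := B.ivl k
  let c := (I.1 + I.2) / 2
  AForm.var c (I.2 - c) k

/-- List access with the zero form as default. -/
def lget (l : List AForm) (i : ℕ) : AForm := l.getD i (AForm.const 0)

/-- Sum of a list of forms. -/
def asum : List AForm → AForm
  | [] => AForm.const 0
  | F :: l => AForm.add F (asum l)

/-- Per-box context of shared affine forms (all at scale `SC`): coordinates `C_k`, `S2_k = 1 − C_k²` (`k < 4`,
index `k`), Wilson masses `A(b)` and inverse denominators `1/h(b)` (`b < 16`, index `b`), tadpoles (index `μ`),
`W(bs)` (index `bs`), the products `A(b)A(b')`, `h(b)⁻¹h(b')⁻¹` (index `16 b + b'`) and `C_μC_ν`, `C_μ S2_ν`,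
`S2_μ S2_ν` (index `4 μ + ν`). -/
structure Ctx where
  /-- `C_k` -/
  c : List AForm
  /-- `1 − C_k²` -/
  q : List AForm
  /-- `A(b) = Σ_k (1 − σ_k C_k)` -/
  a : List AForm
  /-- `1 / h(b)` -/
  ih : List AForm
  /-- `Σ_b 2 (S2_μ − A(b) σ_μ C_μ) / h(b)` -/
  tad : List AForm
  /-- `W(bs) = Σ_k s_k S2_k` -/
  w : List AForm
  /-- `A(b) A(b')` -/
  aa : List AForm
  /-- `h(b)⁻¹ h(b')⁻¹` -/
  ihp : List AForm
  /-- `C_μ C_ν` -/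
  cc : List AForm
  /-- `C_μ S2_ν` -/
  cq : List AForm
  /-- `S2_μ S2_ν` -/
  qq : List AForm

/-- Build the context of a box (`none` if some `h(b)` is not provably positive). -/
def mkCtx (B : IBox) : Option Ctx :=
  let cs := (List.range 4).map (cForm B)
  let qs := (List.range 4).map fun k => AForm.sub (AForm.const SC) (AForm.sq SC (lget cs k))
  let sumq := asum qs
  let as := (List.range 16).map fun b =>
    AForm.sub (AForm.const (4 * SC)) (asum ((List.range 4).map fun k => AForm.mulInt (sgnZ b k) (lget cs k)))
  let ihs? := (List.range 16).map fun b => AForm.inv SC (AForm.add (AForm.sq SC (lget as b)) sumq)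
  if ihs?.all Option.isSome then
    let ihs := ihs?.map fun o => o.getD (AForm.const 0)
    let tads := (List.range 4).map fun μ => asum ((List.range 16).map fun b =>
      AForm.mulInt 2 (AForm.mul SC (AForm.sub (lget qs μ)
        (AForm.mul SC (lget as b) (AForm.mulInt (sgnZ b μ) (lget cs μ)))) (lget ihs b)))
    let ws := (List.range 16).map fun bs => asum ((List.range 4).map fun k => AForm.mulInt (sgnZ bs k) (lget qs k))
    let aas := (List.range 256).map fun t => AForm.mul SC (lget as (t / 16)) (lget as (t % 16))
    let ihps := (List.range 256).map fun t => AForm.mul SC (lget ihs (t / 16)) (lget ihs (t % 16))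
    let ccs := (List.range 16).map fun t => AForm.mul SC (lget cs (t / 4)) (lget cs (t % 4))
    let cqs := (List.range 16).map fun t => AForm.mul SC (lget cs (t / 4)) (lget qs (t % 4))
    let qqs := (List.range 16).map fun t => AForm.mul SC (lget qs (t / 4)) (lget qs (t % 4))
    some ⟨cs, qs, as, ihs, tads, ws, aas, ihps, ccs, cqs, qqs⟩
  else none

/-- The bubble numerator `T(b, bs)_{μν}`, grouped as
`(AA' − W)(σ_μσ_ν C_μC_ν) + (A − A')(σ_μ C_μS2_ν + σ_ν C_νS2_μ) − 2 S2_μS2_ν (+ (−AA' − W) S2_μ on the diagonal)`. -/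
def tForm (X : Ctx) (b bs μ ν : ℕ) : AForm :=
  let b' := b ^^^ bs
  let AA := lget X.aa (16 * b + b')
  let W := lget X.w bs
  let base := AForm.sub
    (AForm.add (AForm.mul SC (AForm.sub AA W) (AForm.mulInt (sgnZ b μ * sgnZ b ν) (lget X.cc (4 * μ + ν))))
      (AForm.mul SC (AForm.sub (lget X.a b) (lget X.a b'))
        (AForm.add (AForm.mulInt (sgnZ b μ) (lget X.cq (4 * μ + ν))) (AForm.mulInt (sgnZ b ν) (lget X.cq (4 * ν + μ))))))
    (AForm.mulInt 2 (lget X.qq (4 * μ + ν)))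
  if μ = ν then AForm.add base (AForm.mul SC (AForm.sub (AForm.neg AA) W) (lget X.q μ)) else base

/-- The bubble `Σ_b 2 T(b, bs)_{μν} · (h(b)⁻¹ h(b ⊕ bs)⁻¹)`. -/
def bubForm (X : Ctx) (bs μ ν : ℕ) : AForm :=
  asum ((List.range 16).map fun b =>
    AForm.mulInt 2 (AForm.mul SC (tForm X b bs μ ν) (lget X.ihp (16 * b + (b ^^^ bs)))))

/-- The entry `H(bs)_{μν}` as an affine form. -/
def entryForm (X : Ctx) (bs μ ν : ℕ) : AForm :=
  AForm.add (if μ = ν then lget X.tad μ else AForm.const 0) (bubForm X bs μ ν)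

/-- Lower end of a form as a rational (value scale). -/
def loQ (F : AForm) : ℚ := ((F.c - F.rad : ℤ) : ℚ) / SC

/-- Upper end of a form as a rational (value scale). -/
def hiQ (F : AForm) : ℚ := ((F.c + F.rad : ℤ) : ℚ) / SC

/-- The upper-triangular entry forms of block `bs` (active axes `act`, `n = |act|`), row-major over `i ≤ j`, with the
lower triangle mirrored: entry `(i, j)` is the form of the axes `(act (min i j), act (max i j))`. -/
def entryTable (X : Ctx) (bs : ℕ) : List AForm :=
  let act := actList bs
  let n := act.length
  let upper := (List.range (n * n)).map fun t =>
    if t / n ≤ t % n then entryForm X bs ((act.getD (t / n) 0).val) ((act.getD (t % n) 0).val) else AForm.const 0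
  (List.range (n * n)).map fun t =>
    let i := t / n
    let j := t % n
    lget upper (min i j * n + max i j)

/-- The per-block test of block `bs` from its entry table. -/
def blockOKbits (γ : ℚ) (X : Ctx) (bs : ℕ) : Bool :=
  let n := (actList bs).length
  if n < 2 then true else
    let tab := entryTable X bs
    let los := tab.map loQ
    let his := tab.map hiQ
    blockOK γ n (fun i j => los.getD (i * n + j) 0) (fun i j => his.getD (i * n + j) 0)

/-- **The leaf test**: build the context and run the per-block test for the fifteen nonzero classes. -/
def leafOK (γ : ℚ) (B : IBox) : Bool :=
  match mkCtx B with
  | none => false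
  | some X => (List.range 16).all fun bs => blockOKbits γ X bs


/-- The certificate of region `r`: all root boxes pass the bisection driver with fuel `fuel`. -/
def certifyRegion (γ : ℚ) (fuel r : ℕ) : Bool := (roots r).all fun B => certify (leafOK γ) fuel B



/-! ### Proof-side bookkeeping definitions -/

/-- Centre of coordinate `k` of a box (scaled). -/
def IBox.cen (B : IBox) (k : ℕ) : ℤ := ((B.ivl k).1 + (B.ivl k).2) / 2

/-- Half-width of coordinate `k` of a box (scaled, rounded up). -/
def IBox.hw (B : IBox) (k : ℕ) : ℤ := (B.ivl k).2 - B.cen k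

/-- Coordinates on `ℕ` indices (`0` beyond `3`). -/
noncomputable def Cn (C : Fin 4 → ℝ) (k : ℕ) : ℝ := if h : k < 4 then C ⟨k, h⟩ else 0

/-- The noise symbols of a point `C` of the box `B`: `ε_k = (C_k S − c_k)/w_k` (`0` if `w_k = 0` or `k ≥ 4`). -/
noncomputable def noise (B : IBox) (C : Fin 4 → ℝ) (k : ℕ) : ℝ :=
  if k < 4 then (if B.hw k = 0 then 0 else (Cn C k * SC - (B.cen k : ℝ)) / (B.hw k : ℝ)) else 0

/-- Everything the leaf test needs to know about a context at a point. -/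
structure CtxSound (X : Ctx) (C : Fin 4 → ℝ) (ε : ℕ → ℝ) : Prop where
  /-- coordinates -/
  c : ∀ k < 4, AForm.mem SC ε (Cn C k) (lget X.c k)
  /-- `1 − C²` -/
  q : ∀ k < 4, AForm.mem SC ε (1 - Cn C k ^ 2) (lget X.q k)
  /-- `A(b)` -/
  a : ∀ b < 16, AForm.mem SC ε (aW C (bitsFun b)) (lget X.a b)
  /-- `1/h(b)` -/
  ih : ∀ b < 16, AForm.mem SC ε (hW C (bitsFun b))⁻¹ (lget X.ih b)
  /-- tadpoles -/
  tad : ∀ μ : Fin 4, AForm.mem SC ε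
    (∑ σ : Fin 4 → ZMod 2, 2 * (s2 C μ - aW C σ * (sgn σ μ * C μ)) / hW C σ) (lget X.tad μ)
  /-- `W(bs)` -/
  w : ∀ bs < 16, AForm.mem SC ε (wS C (bitsFun bs)) (lget X.w bs)
  /-- `A(b)A(b')` -/
  aa : ∀ b < 16, ∀ b' < 16, AForm.mem SC ε (aW C (bitsFun b) * aW C (bitsFun b')) (lget X.aa (16 * b + b'))
  /-- `h(b)⁻¹h(b')⁻¹` -/
  ihp : ∀ b < 16, ∀ b' < 16, AForm.mem SC ε ((hW C (bitsFun b))⁻¹ * (hW C (bitsFun b'))⁻¹) (lget X.ihp (16 * b + b'))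
  /-- `C_μ C_ν` -/
  cc : ∀ μ ν : Fin 4, AForm.mem SC ε (C μ * C ν) (lget X.cc (4 * μ + ν))
  /-- `C_μ S2_ν` -/
  cq : ∀ μ ν : Fin 4, AForm.mem SC ε (C μ * s2 C ν) (lget X.cq (4 * μ + ν))
  /-- `S2_μ S2_ν` -/
  qq : ∀ μ ν : Fin 4, AForm.mem SC ε (s2 C μ * s2 C ν) (lget X.qq (4 * μ + ν))


end Eval

/-! ### One definitional fact shipped with the definitions -/

/-- **Registered helper `stub_checkerCFormEq`**: the coordinate form is the `var` of centre and half-width. -/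
theorem stub_checkerCFormEq : ∀ (B : IBox) (k : ℕ), cForm B k = Literature.Analysis.ValidatedNumerics.AForm.var (IBox.cen B k) (IBox.hw B k) k :=
  fun _ _ => rfl

end Summit.QuantumFields.QCD.Cruxes.CriticalLineDiamagnetism.ChessboardCellGain.Checker
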